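import Literature.Computability.Complexity.EquivalenceProblemsRabinProofs
import HarnessLib

/-!
# `CF = Ker ⟹` factoring in `ZPP` (Fortnow–Grochow 2011, Prop. 4.10): discharge of
# `fortnowGrochow_CF_eq_Ker_factoring`

Sibling proof file (D-0014 append protocol; theorems only) of
`Literature/Computability/Complexity/EquivalenceProblems.lean`, discharging its named fact

> `fortnowGrochow_CF_eq_Ker_factoring : Ker(FP) ⊆ CF(FP) → FACT ∈ ZPP`

— Fortnow–Grochow, *Complexity classes of equivalence problems revisited*, Inform. Comput. 209
(2011) = arXiv:0907.4775, abstract (ii) and Prop. 4.10: "If `CF = Ker` then … integers can be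
factored in probabilistic polynomial time".

The printed proof begins "By hypothesis, the kernel of the Rabin function `x ↦ x² (mod N)`,
`R_N = {(x, y) : x² ≡ y² (mod N)}`, has a canonical form `f ∈ FP`", i.e. it applies `CF = Ker` to
the kernel of the Rabin function, which for that needs to be the kernel of an `FP` function; the
remainder of the proof (random `x`, `y = f(x)`, `gcd(N, x - y)` splits `N` with probability
`≥ 1 - 2/r(N) ≥ 1/2`, recursion on `N/z`, primality by AKS) is the sharper fact
`fortnowGrochow_rabinKernel_factoring`, discharged in `EquivalenceProblemsRabinProofs.lean`
(`fortnowGrochow_rabinKernel_factoring_holds`). This file supplies the first step for the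
statement's Rabin function `rabinFn` (which reads numerals by Mathlib's `decodeNat`):

* `FGRabin.rabinFn_eq_bricks`, `FGRabin.rabinFn_mem_FP` — `rabinFn` is the brick composition
  `⟨a, b⟩ ↦ ⟨a, ⟦b̂⟧ · ⟦b̂⟧ mod ⟦â⟧⟩` with `ŝ = Brick.canonF s = encodeNat (decodeNat s)` the canonical
  numeral of an arbitrary string (`FoldBricks.lean`), hence in `FP`;
* `FGRabin.rabinKernel_mem_KerFP` — so its kernel (`R_N`, uniformly in `N`) is in `Ker(FP)`;
* `fortnowGrochow_CF_eq_Ker_factoring_holds` — the discharge.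

## References

* L. Fortnow, J. A. Grochow, *Complexity classes of equivalence problems revisited*, Inform.
  Comput. 209 (2011) 748–763 = arXiv:0907.4775, Prop. 4.10 and abstract (ii) [FortnowGrochow2011].
* S. Arora, B. Barak, *Computational Complexity: A Modern Approach*, CUP 2009, §1.3 (closure of
  polynomial time under composition) [AroraBarak2009].
-/

noncomputable section

namespace Literature.Computability.Complexity

open _root_.Computability

namespace FGRabin

open Brick in
/-- **The Rabin function is a brick composition**: `⟨a, b⟩ ↦ ⟨a, ⟦b̂⟧ · ⟦b̂⟧ mod ⟦â⟧⟩` with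
`ŝ = Brick.canonF s = encodeNat (decodeNat s)` the canonical numeral of a string, so that Mathlib's
`decodeNat` reading of `rabinFn` is reproduced on every string (`bitsToNat (encodeNat n) = n`).
[cite: FortnowGrochow2011, Prop. 4.10 (proof: the Rabin function)] -/
theorem rabinFn_eq_bricks :
    rabinFn = fanoutFn fstF (remFn ∘ fanoutFn (prodFn ∘ fanoutFn (Brick.canonF ∘ sndF) (Brick.canonF ∘ sndF))
      (Brick.canonF ∘ fstF)) := by
  funext w
  simp [rabinFn, fstF, sndF, Brick.canonF_eq_encodeNat_decodeNat, sq]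

/-- **`rabinFn ∈ FP`** (pairing, canonical numerals, product and remainder bricks; polynomial time
is closed under composition). [cite: FortnowGrochow2011, Prop. 4.10 (proof: "the Rabin function x ↦ x² (mod N)")] -/
theorem rabinFn_mem_FP : rabinFn ∈ FP := by
  rw [rabinFn_eq_bricks]
  exact fanoutFn_mem_FP Brick.fstF_mem_FP (comp_mem_FP Brick.remFn_mem_FP (fanoutFn_mem_FP
    (comp_mem_FP Brick.prodFn_mem_FP (fanoutFn_mem_FP (comp_mem_FP Brick.canonF_mem_FP Brick.sndF_mem_FP)
      (comp_mem_FP Brick.canonF_mem_FP Brick.sndF_mem_FP))) (comp_mem_FP Brick.canonF_mem_FP Brick.fstF_mem_FP)))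

/-- **The Rabin kernel is in `Ker(FP)`**: `R_N = {(x, y) | x² ≡ y² (mod N)}`, uniformly in `N`, is
the kernel of `rabinFn ∈ FP`. [cite: FortnowGrochow2011, Prop. 4.10 (proof)] -/
theorem rabinKernel_mem_KerFP : (fun u v => rabinFn u = rabinFn v) ∈ KerFP :=
  ⟨rabinFn, rabinFn_mem_FP, fun _ _ => Iff.rfl⟩

end FGRabin

/-- **Discharge of `fortnowGrochow_CF_eq_Ker_factoring`** (Fortnow–Grochow 2011, abstract (ii) /
Prop. 4.10: "If `CF = Ker` then … integers can be factored in probabilistic polynomial time",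
rendered `Ker(FP) ⊆ CF(FP) → FACT ∈ ZPP`). As printed: "By hypothesis, the kernel of the Rabin
function `x ↦ x² (mod N)` … has a canonical form `f ∈ FP`" — the kernel of `rabinFn ∈ FP`
(`FGRabin.rabinKernel_mem_KerFP`) lies in `Ker(FP) ⊆ CF(FP)` — and an `FP` canonical form for that
kernel puts `FACT` in `ZPP = RP ∩ coRP` (`fortnowGrochow_rabinKernel_factoring_holds`: random `x`,
`y = f(x)`, gcd splitting with probability `≥ 1/2` for odd composite non-prime-power `N`,
recursion on `N/z`, AKS primality; two zero-error witnesses in `P`).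
[cite: FortnowGrochow2011, Prop. 4.10] -/
theorem fortnowGrochow_CF_eq_Ker_factoring_holds : fortnowGrochow_CF_eq_Ker_factoring := by
  intro hKC
  obtain ⟨-, cf, hcf, hcan⟩ := hKC FGRabin.rabinKernel_mem_KerFP
  exact fortnowGrochow_rabinKernel_factoring_holds ⟨cf, hcf, hcan⟩

end Literature.Computability.Complexity

end
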